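import Summits.BirchSwinnertonDyer.BirchSwinnertonDyer.Theses.PrintX6
import Summits.BirchSwinnertonDyer.BirchSwinnertonDyer.Theorems.PrintX6KobayashiUpperHalf
import Summits.BirchSwinnertonDyer.Rank1Residual.Supersingular.X6RankZeroWitness12927e1LowerHalf
import HarnessLib

/-!
# Route `PrintX6`, leaf A6, residual `EisensteinHalfFiveLeRest`: the census cell `(12927e1, p = 7)` CLOSED ON THE ROUTE'S OWN
# TRUST BASE — `BSD(E,7)` from `PublishedInputsX6` (upper half = the PROVED item `UpperHalfX6`) + `7`-visibility + Cassels–Tate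
# (lower half), and the Rest conclusion at the cell in ROUTE CURRENCY (cell `bsd-print-x6`, seat p4 gen 3 — «explicit
# descent/visibility certificate road»; `--supports` the residual child `EisensteinHalfFiveLeRest` stmt-BirchSwinnertonDyer-21116 as helper; closes no item)

PARTITION currency (D-0054): leaf A6 = X6 ∧ r_an = 0; ONE cell — `E = 12927e1` at `p = 7`, the smallest of the six Rest cells of the
census (all bad primes `3, 31, 139` split multiplicative, so no erratum prime: outside road (E)'s `EisensteinHalfFiveLeErr`), until now
WITHOUT a kernel closure (data row `VisibilityRecords.checked_x6_rankZero_visibility` + Kurihara certificates only); per pair;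
BEYOND-PRINT THEOREM: **NO** (every input is a refereed theorem consumed by name or a kernel computation).

This file composes two landed pieces, exactly as `PrintX6Cell22678e1FromInputs.lean` (p546341) does at `(22678e1, 5)`:
the hW-free LOWER half at the cell (`X6RankZero.missingLowerBoundAt_cell_12927e1_at7`,
`Rank1Residual/Supersingular/X6RankZeroWitness12927e1LowerHalf.lean`: `(ℤ/7)² ↪ Ш(E)[7]` made visible in `E × F` by the
`7`-congruent rank-2 partner `F = 12927d1`, the congruence PROVED in the kernel by a rational point of Fisher's `X_E(7)`
(`sevenCongruent_x6_12927e1_12927d1_7`, modulo Fisher 2014 Thm 4.8), Cremona–Mazur/Fisher local conditions decided in the kernel,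
`rank F ≥ 2` by the rank-2 observatory's kernel certificate, Cassels–Tate; binders `hCT hGZK hϖ hU hU2 hF44 hF7`, models, newform,
enclosure) and the route's UPPER half (`X6.missingUpperBoundAt_rankZero_of_thm41` = item `UpperHalfX6`'s chain: Kobayashi 2003
Thm 4.1 / Thm 1.2 + B. D. Kim 2013 Cor 3.15 + period units + Pollack + modularity + GZK, conjuncts of `PublishedInputsX6`;
`p`-adic surjectivity at `7` automatic on X6). `hϖ` and `hGZK` ARE conjuncts 4 and 9 of the inputs, so the binders are exactly:
`PublishedInputsX6`, Cassels–Tate, Tate uniformisation ×2, Fisher 2016 Thm 4.4, Fisher 2014 Thm 4.8, the two minimal models, the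
newform `f`/`hf`, and the engine's level-one enclosure `hball0` of `L(E,1)/Ω = 98` (kit j284736, two engines). `ClassX6 W 7` and
`r_an = 0` are derived (integer model + point count; the enclosure + modularity).

References: [Kobayashi2003] Thm 1.2/4.1; [BDKim2013] Cor 3.15; [CremonaMazur2000] §3; [Fisher2016Visualizing7] Thm 4.4;
[Fisher2014SevenElevenCongruent] Thm 4.8; [SilvermanAEC2009] X.4.14; [Miller2011LMS] Def 1.1; HOME/PLAN.md (p4 road).
-/

set_option autoImplicit false
set_option linter.dupNamespace false

noncomputable section

open scoped Classical MatrixGroups ModularForm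

open CongruenceSubgroup WeierstrassCurve Literature.NumberTheory.EllipticCurves
  Literature.NumberTheory.EllipticCurves.Rank1Residual
  Literature.NumberTheory.EllipticCurves.Rank1Residual.Typed
  Literature.NumberTheory.EllipticCurves.Fisher2016
  Literature.NumberTheory.EllipticCurves.Fisher2014
  Literature.NumberTheory.EllipticCurves.ModularForms
  Summit.BirchSwinnertonDyer.BirchSwinnertonDyer.Rank1Residual.IntModel
  Summit.BirchSwinnertonDyer.Rank1Residual.X11b
  Summit.BirchSwinnertonDyer.Rank1Residual.Supersingular
  Summit.BirchSwinnertonDyer.BirchSwinnertonDyer.Theses.PrintX6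

namespace Summit.BirchSwinnertonDyer.BirchSwinnertonDyer.Theorems.PrintX6

/-- **`BSD(E,7)` for `E = 12927e1` on the route's trust base — no Wuthrich Prop. 21, no flagged fact.** Binders: the route's input
pack `PublishedInputsX6` (upper half via `X6.missingUpperBoundAt_rankZero_of_thm41`; its conjunct 4 is the period comparison `hϖ`
and conjunct 9 is GZK, both re-used by the lower half), Cassels–Tate `hCT`, Tate uniformisation `hU`/`hU2`, Fisher 2016 Thm 4.4
`hF44`, Fisher 2014 Thm 4.8 `hF7`, the minimal models of `E` and of its rank-2 `7`-congruent partner `F = 12927d1`, the newform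
`f`/`hf`, the engine's enclosure `hball0` of `L(E,1)/Ω = 98`. Lower half: `X6RankZero.missingLowerBoundAt_cell_12927e1_at7`
(`7`-visibility + CT); `ClassX6 W 7` from the integer model (`classX6_of_intModel`, `card_c12927e1_7`); `r_an = 0` from the
enclosure (`L(E,1) = 0` contradicts `|mid − 98| ≤ 10⁻²⁰ ∧ |mid| ≤ 10⁻²⁰`) and modularity (conjunct 8); then the two halves and GZK
(`missingPPartAt_of_lower_of_upper`, `bsdp_of_missingPPartAt`). Per pair; not a class theorem.
[cite: Kobayashi2003, Thm. 4.1 (p. 8) and Thm. 1.2 (p. 2)] [cite: BDKim2013, Cor. 3.15 (p. 199)] [cite: CremonaMazur2000, §3]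
[cite: Fisher2016Visualizing7, Thm. 4.4] [cite: Fisher2014SevenElevenCongruent, Thm. 4.8] [cite: SilvermanAEC2009, Thm. X.4.14]
[cite: Miller2011LMS, §1 and Def. 1.1] -/
theorem X6.bsdp_12927e1_at7_of_publishedInputsX6 (hPub : PublishedInputsX6)
    (hCT : exists_casselsTate_pairing (K := ℚ))
    (hU : Silverman1994_thmV53_tateUniformisation.{0})
    (hU2 : Silverman1994_thmV53_corV54_tateUniformisation.{0})
    (hF44 : thm44_selmerLocalKer_iff_of_nonsplit_good) (hF7 : thm48_sevenCongruent_twistQuartic7)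
    {W F : WeierstrassCurve ℚ} [W.IsElliptic] [W.IsGloballyMinimal] [F.IsElliptic] [F.IsGloballyMinimal]
    (hWeq : W = ⟨1, 0, 0, -42189461, -105479619702⟩) (hFeq : F = ⟨1, 0, 0, -137, 606⟩)
    {N : ℕ} [NeZero N] (f : CuspForm (Gamma0 N) 2) (hf : IsNewformOf W f)
    (hball0 : ∃ mid rad : ℝ, rad ≤ 1 / 10 ^ (20 : ℕ) ∧ |mid - ((98 : ℤ) : ℝ)| ≤ 1 / 10 ^ (20 : ℕ) ∧
      |((1 : ℕ) : ℝ) * (((1 : ℕ) : ℝ) * ((W.entireLFunction 1).re / plusPeriod f)) - mid| ≤ rad) :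
    BSDp W 7 := by
  haveI : Fact (Nat.Prime 7) := ⟨by norm_num⟩
  obtain ⟨h12, h41, hKim, hϖ, h3, -, hmod, hmod', hGZK⟩ := hPub
  -- the class predicate at 7 from the integer model
  have hIW : integralModelInt W = ⟨1, 0, 0, -42189461, -105479619702⟩ :=
    integralModelInt_eq_of_map_eq _ (by rw [hWeq]; ext <;> simp [WeierstrassCurve.map])
  have hX : ClassX6 W 7 :=
    classX6_of_intModel 7 (by norm_num) hIW (by decide +kernel) card_c12927e1_7 (by decide) (by decide +kernel)
  -- `r_an = 0` from the enclosure
  have hL : W.entireLFunction 1 ≠ 0 := by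
    obtain ⟨mid, rad, hrad, hmid, hball⟩ := hball0
    intro hL0
    rw [hL0] at hball
    simp only [Complex.zero_re, zero_div, mul_zero, zero_sub, abs_neg] at hball
    rw [abs_le] at hmid hball
    norm_num at hmid hball hrad
    linarith [hmid.1, hball.2]
  have hr0 : W.analyticRank = 0 := (W.analyticRank_eq_zero_iff_holds (hmod' W)).2 hL
  -- lower half (7-visibility + Cassels–Tate, hW-free) and upper half (the route's)
  have hlow : MissingLowerBoundAt W 7 :=
    X6RankZero.missingLowerBoundAt_cell_12927e1_at7 hCT hGZK hϖ hU hU2 hF44 hF7 hWeq hFeq f hf hball0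
  exact bsdp_of_missingPPartAt W 7 hGZK (by omega)
    (missingPPartAt_of_lower_of_upper W 7 hlow
      (X6.missingUpperBoundAt_rankZero_of_thm41 W 7 h41 h12 hKim hϖ h3 hmod hmod' hGZK (by norm_num) hX hr0))

/-- **The Rest conclusion AT THE CELL `(12927e1, 7)` in ROUTE CURRENCY** — the T3-witness shape for the residual child
`EisensteinHalfFiveLeRest` (and for its parent `EisensteinHalfFiveLe`): with `hGZK` and `hϖ` projected out of `PublishedInputsX6`
(conjuncts 9 and 4) and the remaining binders verbatim (`hCT hU hU2 hF44 hF7`, models, newform, enclosure),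
`∀ q : ℚ, #Ш(E)_an = q → ord₇ q ≠ 0 → ord₇ q ≤ ord₇ #Ш(E/ℚ)`. This is `X6RankZero.eisensteinHalfFiveLeRest_cell_12927e1_at7`
re-keyed to the route's input pack; no Kato-side input is used (the conclusion is a LOWER bound). Per pair; not a class theorem.
[cite: CremonaMazur2000, §3] [cite: Fisher2014SevenElevenCongruent, Thm. 4.8] [cite: Fisher2016Visualizing7, Thm. 4.4]
[cite: SilvermanAEC2009, Thm. X.4.14] [cite: Miller2011LMS, Def. 1.1] -/
theorem X6.eisensteinHalfFiveLeRest_cell_12927e1_at7_of_publishedInputsX6 (hPub : PublishedInputsX6)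
    (hCT : exists_casselsTate_pairing (K := ℚ))
    (hU : Silverman1994_thmV53_tateUniformisation.{0})
    (hU2 : Silverman1994_thmV53_corV54_tateUniformisation.{0})
    (hF44 : thm44_selmerLocalKer_iff_of_nonsplit_good) (hF7 : thm48_sevenCongruent_twistQuartic7)
    {W F : WeierstrassCurve ℚ} [W.IsElliptic] [W.IsGloballyMinimal] [F.IsElliptic] [F.IsGloballyMinimal]
    (hWeq : W = ⟨1, 0, 0, -42189461, -105479619702⟩) (hFeq : F = ⟨1, 0, 0, -137, 606⟩)
    {N : ℕ} [NeZero N] (f : CuspForm (Gamma0 N) 2) (hf : IsNewformOf W f)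
    (hball0 : ∃ mid rad : ℝ, rad ≤ 1 / 10 ^ (20 : ℕ) ∧ |mid - ((98 : ℤ) : ℝ)| ≤ 1 / 10 ^ (20 : ℕ) ∧
      |((1 : ℕ) : ℝ) * (((1 : ℕ) : ℝ) * ((W.entireLFunction 1).re / plusPeriod f)) - mid| ≤ rad) :
    ∀ q : ℚ, shaAn W = (q : ℂ) → padicValRat 7 q ≠ 0 → padicValRat 7 q ≤ (padicValNat 7 W.shaOrder : ℤ) :=
  X6RankZero.eisensteinHalfFiveLeRest_cell_12927e1_at7 hCT hPub.2.2.2.2.2.2.2.2 hPub.2.2.2.1 hU hU2 hF44 hF7 hWeq hFeq f hf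
    hball0

end Summit.BirchSwinnertonDyer.BirchSwinnertonDyer.Theorems.PrintX6

end
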